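import Summits.BirchSwinnertonDyer.Rank1Residual.Additive.KatoDescentKummerUnramifiedCount
import Summits.BirchSwinnertonDyer.BirchSwinnertonDyer.Theorems.SchneiderFreeAdditiveX3PoitouTateSelmerDualityHolds
import Summits.BirchSwinnertonDyer.Rank1Residual.X11b.KummerStructureDuality
import Literature.NumberTheory.EllipticCurves.WeilPairingProofs
import HarnessLib

set_option autoImplicit false

/-!
# (R1-d) AT FINITE LEVEL, UNCONDITIONALLY: the count `#H¹_{𝓚 ⊔ ur@Σ}(K, E[p^k]) · ∏_{v∈Σ} #𝓚_v =
# #H¹_{𝓚 ⊓ ur@Σ}(K, E[p^k]) · ∏_{v∈Σ} #(𝓚_v ⊔ H¹_ur(K_v, E[p^k]))` over every number field `K : Type`, `p` odd —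
# Poitou–Tate and the Weil data DISCHARGED (seat `bsd-cm-prr-ty1` g11, cell `bsd-cm`; theorems only: no definition,
# no named fact, no instance, no `sorry`)

Part 23 of the seat's kernel cut of stub 3 `stub_rankOneCountReadingKato` of the Kato–Perrin-Riou skeletons v4 (cruxes
stmt-BirchSwinnertonDyer-19945 / -19223; = cell bsd-potss's held input 27322).  Sequel of Part 22
`KatoDescentKummerUnramifiedCount` (the hypothesis form `natCard_selmerGroup_kummerSupUnramified_mul` over a Poitou–Tate family
`inv` and Weil data `e` at an odd prime-power level `n`).  Here `n = p^k` (`p` an odd prime, `k ≥ 1`) over a number field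
`K : Type`, and every input is a tree theorem:

* Poitou–Tate for Selmer structures — `poitouTate_selmerStructure_duality_holds K` (cell bsd-schneider: Milne I Cor. 2.3 ∧
  Thm. 4.10 (b) ∧ Thm. 2.6 ∧ Howard Thm. 2.1.11 for every number field, real places included);
* the Weil pairing on `E[p^k]` — `WeierstrassCurve.exists_weilPairing_holds` (Silverman III.8.1);
* `𝓚_v = H¹_ur(K_v, E[p^k])` at every good `v ∤ p` and `E[p^k]` unramified there — X11b
  `KummerDuality.kummerSelmerStructure_isUnramifiedOutside`, `AcSelmer.isUnramifiedAt_torsionGaloisModule` (Silverman VII.4.1).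

* **`natCard_selmerGroup_kummerSupUnramified_mul_of_prime_pow`** — for finite sets `Σ ⊆ T` of finite places with `v ∤ p` on
  `Σ` and `T ⊇ {v ∣ p} ∪ {bad places}`, and ANY Selmer structures `𝓖`, `𝓖'` on `E[p^k]` of the shape «`𝓚_v ⊔ H¹_ur` resp.
  `𝓚_v ⊓ H¹_ur` at `v ∈ Σ`, `𝓚_v` at the other finite places» (anything at `∞`):
  `#H¹_𝓖(K, E[p^k]) · ∏_{v∈Σ} #𝓚_v = #H¹_{𝓖'}(K, E[p^k]) · ∏_{v∈Σ} #(𝓚_v ⊔ H¹_ur(K_v, E[p^k]))`.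
* **`relIndex_selmerGroup_kummerInfUnramified_eq_of_prime_pow`** — the index form
  `[H¹_𝓖(K, E[p^k]) : H¹_{𝓖'}(K, E[p^k])] = ∏_{v∈Σ} [𝓚_v ⊔ H¹_ur(K_v, E[p^k]) : 𝓚_v]` (with `𝓖'_w ≤ 𝓖_w` at `∞`).

UNIVERSES: Part 22's hypothesis form is stated over `K : Type u` (its Poitou–Tate family `inv : LocalInvariants K n` is a
binder); THIS file is over `K : Type` (universe 0) because the tree's discharge `poitouTate_selmerStructure_duality_holds` (cell
bsd-schneider) is stated at `Type` — do not try to feed Part 22 at `Type u` from here.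

WHAT THIS IS AND IS NOT, against the potss memo's (R1-d) «`#(S(T)/E(ℚ)⊗ℚ_p/ℤ_p) = #Ш[p^∞] · C′/p^a`» (Kato (14.9.3) / Rubin
Thm. 1.7.3 for `ℱ = Kummer ⊂ ℱ′ = Kummer + unramified at the bad ℓ ≠ p`, on `E[p^∞]` / `T_pE`): the identity here is its
LEVEL-`p^k` form `[H¹_{𝓚 ⊔ ur@Σ}(K, E[p^k]) : H¹_{𝓚 ⊓ ur@Σ}(K, E[p^k])] = ∏_{v∈Σ} [𝓚_v ⊔ H¹_ur(K_v, E[p^k]) : 𝓚_v]`.  The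
right-hand side is the level-`p^k` avatar of `C′ = ∏_{ℓ∈Σ} c_ℓ^{(p)}`: at an ADDITIVE `v ∤ p` (every bad prime of a CM curve)
`[𝓚_v ⊔ H¹_ur : 𝓚_v] = #E(K_v)[p^k]`, `= #E(K_v)[p^∞] = p^{v_p(c_v)}` for `k ≫ 0` — the sequel Part 24
(`KatoDescentKummerUnramifiedLocalIndex`, from n1011 `UnramifiedKummerDisjoint` / `InertialTorsionAdditive` and cell bsd-potss's
`natCard_primaryComponent_point_eq_pow_padicValNat_localTamagawaNumber_of_hasAdditiveReductionAt`).  What REMAINS between this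
and (R1-d) is the passage `k → ∞` on the global side: `H¹_{𝓚 ⊔ ur@Σ}(ℚ, W[p^k])` versus Kato's `S(T)[p^k]`, `H¹_𝓚 = Sel^{(p^k)}`
versus `Sel_{p^∞}[p^k]` (so that `[S(T) : Sel_{p^∞}]`-type indices appear), and `H¹_{𝓚 ⊓ ur@Σ}` versus
`𝔥 = H¹(ℤ[1/p], T_pW) = p^a ℤ_p κ_∞(P)` inside `lim_k H¹_𝓚 = ℤ_p κ_∞(P)` (Parts 19–21), which produces the `p^a` — not done here.

HONEST LABEL: theorems only; no stub or item is closed; nothing is registered; nothing is asserted on 19945 / 19223;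
Kato's Main Conjecture and Perrin-Riou's conjecture are not touched; BSD is not proved for any curve.

References: [Rubin2000] Thm. 1.7.3; [MilneADT2006] Ch. I Thm. 2.6, Cor. 3.4, Thm. 4.10; [Howard2004HeegnerKolyvagin] Thm. 2.1.11
(arXiv:1202.6340 p. 6); [SilvermanAEC2009] III.8.1, VII.4.1; [Kato2004Asterisque] §14.8 (p. 238), (14.9.3) (p. 240).
-/

noncomputable section

open scoped Classical ContRepresentation NumberField
open Function Field NumberField IsDedekindDomain WeierstrassCurve
open Literature.NumberTheory.EllipticCurves Literature.NumberTheory.GaloisRepresentations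
  Literature.NumberTheory.GaloisRepresentations.DiscreteGaloisModule Literature.NumberTheory.GaloisCohomology
open Summit.BirchSwinnertonDyer.Rank1Residual.X11b.Levels Summit.BirchSwinnertonDyer.Rank1Residual.X11b.LocBridge
open Summit.BirchSwinnertonDyer.Rank1Residual.GaloisImage

namespace Summit.BirchSwinnertonDyer.Rank1Residual.Additive.KummerUnramified

/-! ## The count for `n = p^k` over `K : Type`, all inputs discharged -/

section Discharged

variable {K : Type} [Field K] [NumberField K] (W : WeierstrassCurve K) [W.IsElliptic] (p k : ℕ) [Fact p.Prime]

/-- **(R1-d) at the finite level `p^k`, UNCONDITIONAL over every number field `K : Type`**: for an odd prime `p`, `k ≥ 1`,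
finite sets `Σ ⊆ T` of finite places with `v ∤ p` on `Σ` and `T ⊇ {v ∣ p} ∪ {bad places}`, and ANY Selmer structures
`𝓖`, `𝓖'` on `E[p^k]` of the shape «`𝓚_v ⊔ H¹_ur` resp. `𝓚_v ⊓ H¹_ur` at `v ∈ Σ`, `𝓚_v` at the other finite places»:
`#H¹_𝓖(K, E[p^k]) · ∏_{v∈Σ} #𝓚_v = #H¹_{𝓖'}(K, E[p^k]) · ∏_{v∈Σ} #(𝓚_v ⊔ H¹_ur(K_v, E[p^k]))`.  Inputs, all tree theorems:
Poitou–Tate for Selmer structures `poitouTate_selmerStructure_duality_holds K` (Milne I 4.10 (b), cell bsd-schneider), the Weil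
pairing `exists_weilPairing_holds` (Silverman III.8.1), `𝓚_v = H¹_ur` at good `v ∤ p` and `E[p^k]` unramified there (X11b).
[cite: Rubin2000, Thm. 1.7.3] [cite: MilneADT2006, Ch. I, Thm. 4.10] [cite: SilvermanAEC2009, III.8.1 and VII.4.1] -/
theorem natCard_selmerGroup_kummerSupUnramified_mul_of_prime_pow (hodd : p ≠ 2) (hk : 1 ≤ k)
    (Q T : Finset (HeightOneSpectrum (𝓞 K))) (hQT : Q ⊆ T)
    (hQp : ∀ v ∈ Q, ((p : ℕ) : 𝓞 K) ∉ v.asIdeal)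
    (hTp : ∀ v : HeightOneSpectrum (𝓞 K), ((p : ℕ) : 𝓞 K) ∈ v.asIdeal → v ∈ T)
    (hTbad : ∀ v : HeightOneSpectrum (𝓞 K), ¬ W.HasGoodReductionAt v → v ∈ T)
    (𝓖 𝓖' : SelmerStructure (W.torsionGaloisModule ((p ^ k : ℕ) : ℤ)))
    (h𝓖Q : ∀ v ∈ Q, 𝓖 (Sum.inr v) = W.kummerSelmerStructure ((p ^ k : ℕ) : ℤ) (Sum.inr v) ⊔
      unramifiedSubgroup (GaloisRep.toLocal v (W.torsionGaloisModule ((p ^ k : ℕ) : ℤ))) 1)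
    (h𝓖nQ : ∀ v ∉ Q, 𝓖 (Sum.inr v) = W.kummerSelmerStructure ((p ^ k : ℕ) : ℤ) (Sum.inr v))
    (h𝓖'Q : ∀ v ∈ Q, 𝓖' (Sum.inr v) = W.kummerSelmerStructure ((p ^ k : ℕ) : ℤ) (Sum.inr v) ⊓
      unramifiedSubgroup (GaloisRep.toLocal v (W.torsionGaloisModule ((p ^ k : ℕ) : ℤ))) 1)
    (h𝓖'nQ : ∀ v ∉ Q, 𝓖' (Sum.inr v) = W.kummerSelmerStructure ((p ^ k : ℕ) : ℤ) (Sum.inr v)) :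
    Nat.card 𝓖.selmerGroup * ∏ v ∈ Q, Nat.card (W.kummerSelmerStructure ((p ^ k : ℕ) : ℤ) (Sum.inr v)) =
      Nat.card 𝓖'.selmerGroup * ∏ v ∈ Q, Nat.card ↥(W.kummerSelmerStructure ((p ^ k : ℕ) : ℤ) (Sum.inr v) ⊔
        unramifiedSubgroup (GaloisRep.toLocal v (W.torsionGaloisModule ((p ^ k : ℕ) : ℤ))) 1) := by
  have hp : p.Prime := Fact.out
  haveI : NeZero (p ^ k) := ⟨pow_ne_zero k hp.ne_zero⟩
  haveI : Finite (geomTorsion W ((p ^ k : ℕ) : ℤ)) := finite_geomTorsion_of_neZero W (p ^ k)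
  have hn : IsPrimePow (p ^ k) := (hp.isPrimePow).pow (Nat.one_le_iff_ne_zero.1 hk)
  have hodd' : Odd (p ^ k) := (hp.odd_of_ne_two hodd).pow
  have hnK : ((p ^ k : ℕ) : K) ≠ 0 := Nat.cast_ne_zero.2 (NeZero.ne (p ^ k))
  obtain ⟨e, hμ, hadd₁, hadd₂, halt, hnondeg, hgal⟩ := exists_weilPairing_holds W (p ^ k) hn.two_le hnK
  obtain ⟨inv, hperf, hsum, -, hcompl⟩ :=
    Summit.BirchSwinnertonDyer.BirchSwinnertonDyer.Theorems.SchneiderFreeAdditiveX3.PoitouTateReduction.poitouTate_selmerStructure_duality_holds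
      K (p ^ k)
  -- `v ∣ p^k ↔ v ∣ p`
  have hdvd : ∀ v : HeightOneSpectrum (𝓞 K), (((p ^ k : ℕ) : ℕ) : 𝓞 K) ∈ v.asIdeal → ((p : ℕ) : 𝓞 K) ∈ v.asIdeal :=
    fun v h => by
      rw [Nat.cast_pow] at h
      exact v.isPrime.mem_of_pow_mem k h
  -- `𝓚_v = H¹_ur` off `T`, `E[p^k]` unramified off `T`
  have hKur := X11b.KummerDuality.kummerSelmerStructure_isUnramifiedOutside W p k (finSupport T)
    (fun w => inl_mem_finSupport T w) (fun v hv => (inr_mem_finSupport_iff T v).2 (hTp v hv))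
    (fun v hv => (inr_mem_finSupport_iff T v).2 (hTbad v hv))
  have h𝓚T : ∀ v : HeightOneSpectrum (𝓞 K), v ∉ T → W.kummerSelmerStructure ((p ^ k : ℕ) : ℤ) (Sum.inr v) =
      unramifiedSubgroup (GaloisRep.toLocal v (W.torsionGaloisModule ((p ^ k : ℕ) : ℤ))) 1 :=
    fun v hv => hKur.2 v (fun h => hv ((inr_mem_finSupport_iff T v).1 h))
  have hT : ∀ v : HeightOneSpectrum (𝓞 K), v ∉ T →
      GaloisRep.IsUnramifiedAt v (W.torsionGaloisModule ((p ^ k : ℕ) : ℤ)) := fun v hv =>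
    X11b.AcSelmer.isUnramifiedAt_torsionGaloisModule W (by by_contra h; exact hv (hTbad v h))
      (X11b.AcSelmer.intCast_pow_not_mem p (fun h => hv (hTp v h)) k)
  exact natCard_selmerGroup_kummerSupUnramified_mul W (p ^ k) e hμ hadd₁ hadd₂ hgal halt hnondeg hn hodd' inv hperf hsum
    hcompl Q T hQT (fun v hv h => hQp v hv (hdvd v h)) (fun v h => hTp v (hdvd v h)) hT h𝓚T 𝓖 𝓖' h𝓖Q h𝓖nQ h𝓖'Q
    h𝓖'nQ

/-- **The index form, UNCONDITIONAL**: `[H¹_𝓖(K, E[p^k]) : H¹_{𝓖'}(K, E[p^k])] = ∏_{v∈Σ} [𝓚_v ⊔ H¹_ur(K_v, E[p^k]) : 𝓚_v]`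
(hypotheses as in `natCard_selmerGroup_kummerSupUnramified_mul_of_prime_pow`, plus `𝓖'_w ≤ 𝓖_w` at the infinite places).
[cite: Rubin2000, Thm. 1.7.3] [cite: MilneADT2006, Ch. I, Thm. 4.10] -/
theorem relIndex_selmerGroup_kummerInfUnramified_eq_of_prime_pow (hodd : p ≠ 2) (hk : 1 ≤ k)
    (Q T : Finset (HeightOneSpectrum (𝓞 K))) (hQT : Q ⊆ T)
    (hQp : ∀ v ∈ Q, ((p : ℕ) : 𝓞 K) ∉ v.asIdeal)
    (hTp : ∀ v : HeightOneSpectrum (𝓞 K), ((p : ℕ) : 𝓞 K) ∈ v.asIdeal → v ∈ T)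
    (hTbad : ∀ v : HeightOneSpectrum (𝓞 K), ¬ W.HasGoodReductionAt v → v ∈ T)
    (𝓖 𝓖' : SelmerStructure (W.torsionGaloisModule ((p ^ k : ℕ) : ℤ)))
    (h𝓖Q : ∀ v ∈ Q, 𝓖 (Sum.inr v) = W.kummerSelmerStructure ((p ^ k : ℕ) : ℤ) (Sum.inr v) ⊔
      unramifiedSubgroup (GaloisRep.toLocal v (W.torsionGaloisModule ((p ^ k : ℕ) : ℤ))) 1)
    (h𝓖nQ : ∀ v ∉ Q, 𝓖 (Sum.inr v) = W.kummerSelmerStructure ((p ^ k : ℕ) : ℤ) (Sum.inr v))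
    (h𝓖'Q : ∀ v ∈ Q, 𝓖' (Sum.inr v) = W.kummerSelmerStructure ((p ^ k : ℕ) : ℤ) (Sum.inr v) ⊓
      unramifiedSubgroup (GaloisRep.toLocal v (W.torsionGaloisModule ((p ^ k : ℕ) : ℤ))) 1)
    (h𝓖'nQ : ∀ v ∉ Q, 𝓖' (Sum.inr v) = W.kummerSelmerStructure ((p ^ k : ℕ) : ℤ) (Sum.inr v))
    (h𝓖'inl : ∀ w : InfinitePlace K, 𝓖' (Sum.inl w) ≤ 𝓖 (Sum.inl w)) :
    𝓖'.selmerGroup ≤ 𝓖.selmerGroup ∧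
      𝓖'.selmerGroup.relIndex 𝓖.selmerGroup =
        ∏ v ∈ Q, (W.kummerSelmerStructure ((p ^ k : ℕ) : ℤ) (Sum.inr v)).relIndex
          (W.kummerSelmerStructure ((p ^ k : ℕ) : ℤ) (Sum.inr v) ⊔
            unramifiedSubgroup (GaloisRep.toLocal v (W.torsionGaloisModule ((p ^ k : ℕ) : ℤ))) 1) := by
  have hp : p.Prime := Fact.out
  haveI : NeZero (p ^ k) := ⟨pow_ne_zero k hp.ne_zero⟩
  haveI : Finite (geomTorsion W ((p ^ k : ℕ) : ℤ)) := finite_geomTorsion_of_neZero W (p ^ k)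
  have hn : IsPrimePow (p ^ k) := (hp.isPrimePow).pow (Nat.one_le_iff_ne_zero.1 hk)
  have hodd' : Odd (p ^ k) := (hp.odd_of_ne_two hodd).pow
  have hnK : ((p ^ k : ℕ) : K) ≠ 0 := Nat.cast_ne_zero.2 (NeZero.ne (p ^ k))
  obtain ⟨e, hμ, hadd₁, hadd₂, halt, hnondeg, hgal⟩ := exists_weilPairing_holds W (p ^ k) hn.two_le hnK
  obtain ⟨inv, hperf, hsum, -, hcompl⟩ :=
    Summit.BirchSwinnertonDyer.BirchSwinnertonDyer.Theorems.SchneiderFreeAdditiveX3.PoitouTateReduction.poitouTate_selmerStructure_duality_holds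
      K (p ^ k)
  have hdvd : ∀ v : HeightOneSpectrum (𝓞 K), (((p ^ k : ℕ) : ℕ) : 𝓞 K) ∈ v.asIdeal → ((p : ℕ) : 𝓞 K) ∈ v.asIdeal :=
    fun v h => by
      rw [Nat.cast_pow] at h
      exact v.isPrime.mem_of_pow_mem k h
  have hKur := X11b.KummerDuality.kummerSelmerStructure_isUnramifiedOutside W p k (finSupport T)
    (fun w => inl_mem_finSupport T w) (fun v hv => (inr_mem_finSupport_iff T v).2 (hTp v hv))
    (fun v hv => (inr_mem_finSupport_iff T v).2 (hTbad v hv))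
  have h𝓚T : ∀ v : HeightOneSpectrum (𝓞 K), v ∉ T → W.kummerSelmerStructure ((p ^ k : ℕ) : ℤ) (Sum.inr v) =
      unramifiedSubgroup (GaloisRep.toLocal v (W.torsionGaloisModule ((p ^ k : ℕ) : ℤ))) 1 :=
    fun v hv => hKur.2 v (fun h => hv ((inr_mem_finSupport_iff T v).1 h))
  have hT : ∀ v : HeightOneSpectrum (𝓞 K), v ∉ T →
      GaloisRep.IsUnramifiedAt v (W.torsionGaloisModule ((p ^ k : ℕ) : ℤ)) := fun v hv =>
    X11b.AcSelmer.isUnramifiedAt_torsionGaloisModule W (by by_contra h; exact hv (hTbad v h))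
      (X11b.AcSelmer.intCast_pow_not_mem p (fun h => hv (hTp v h)) k)
  exact relIndex_selmerGroup_kummerInfUnramified_eq W (p ^ k) e hμ hadd₁ hadd₂ hgal halt hnondeg hn hodd' inv hperf hsum
    hcompl Q T hQT (fun v hv h => hQp v hv (hdvd v h)) (fun v h => hTp v (hdvd v h)) hT h𝓚T 𝓖 𝓖' h𝓖Q h𝓖nQ h𝓖'Q
    h𝓖'nQ h𝓖'inl

end Discharged

end Summit.BirchSwinnertonDyer.Rank1Residual.Additive.KummerUnramified

end
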